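import Summits.QuantumFields.YangMills.Theorems.BalabanUVNodesN07DataDownTheTowerBlowDown
import Summits.QuantumFields.YangMills.Theorems.BalabanUVNodesN07FinePathCrossingCount
import Summits.QuantumFields.YangMills.Theorems.BalabanUVNodesN07RadialAxialTower
import Summits.QuantumFields.YangMills.Theorems.BalabanUVNodesN07RadialGaugeWithinBlock
import HarnessLib

/-!
# DAG node N07 [B11] — (145)∕(151) DOWN THE RADIAL TOWER, the within-block letters SUPPLIED: at a representative carrying the RADIAL axial tower ([6] (1.15) on [B5] (1.7)'s contours, this base's
# FILE 4) the per-level within-block letter `τ_i` of FILES 5–8 IS dag-n07-w5's `dist1_le_of_axialGauge_radial_hint` (p630918): `τ_i := (d(L−1)+1)·(d−1)(L−1)·a_i` from the level-`i` plaquette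
# letter `a_i` — so the ladder `v_j` on blow-down windows (FILE 6) and the fine-path sum for n07-w8 g5's variation door (FILE 8) hold with ONLY the per-level (7)-smallness of the representative's
# averages, the top letter (module 40 at the (147) representative) and the window geometry displayed

Cell `pub-ymgap` (HUMAN RULINGS D-0062 ∕ D-0088 ∕ D-0149), width seat `pub-ymgap-dag-n07-w6` (second wave), harness re-seat g0″, 2026-08-28; CLAIM-9 (own lineage FILES 4–8 + n07-w5 g2's supplier, lane owner's
ROAD WORD (S)).  `--kind proof --supports stmt-QuantumFields-27364 --as helper` (K1⁹ per dag-lead KEY MAP v2; count-neutral).  THEOREMS ONLY.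

THE PRINT.  [B11] = [Balaban1985Variational] pp. 300–302: «U′_k ∈ Ax_k(□̃(k), 1) … the generalized axial gauge conditions imply |U′_k(x,x′) − 1| < |x − y|2L²ε₀ (145)», (146), (147), (151) «|V″ − 1| <
9dL²Mε₀ on 𝔅_k»; [6] = [Balaban1985RegularSpaces] (1.15) p. 78, Lemma 1 (1.25) p. 79; [B5] = [Balaban1984PropagatorsI] (1.7) p. 18.

WHAT THIS FILE DOES (by-name composition; NOTHING of [B11]∕[6]∕[B5] analysis asserted).
* §1 ★ `hint_of_radialTower` — FILES 5–8's within-block binder `hint` for a representative whose averages `M^i U′`, `i < k`, carry the RADIAL axial gauge: from the plaquette letters «plaquettes of `M^i U′`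
  BASED in the blocks `y ∈ W (i+1)` are `< a_i`» by n07-w5's `dist1_le_of_axialGauge_radial_hint`, with `τ_i := (d(L−1)+1)·((d−1)(L−1)·a_i)`.
* §2 ★★★ `dist1_iter_le_down_the_radialTower_blowDown` — FILE 6's `dist1_iter_le_down_the_tower_blowDown` at a radial-tower representative with `hint` DISCHARGED: inputs = per-level plaquette letters of
  `M^i U′` (two shapes: around the `(i+1)`-bonds of the level-`(i+1)` box for [6] Lemma 1, and based in its blocks for the within-block letter), the top letter `v_k` on the top box, the ladder with
  `τ_i := (d(L−1)+1)(d−1)(L−1)·a_i`; ★★★★ `dist1_iter_le_down_the_radialRep_blowDown` — the same at the (147) representative `U″ := U′^{h̄}` of a radial-tower `U′` with the TOP letter `(d−1)nδ` from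
  module 40 (FILE 6's capstone; the radial tower of `U″` by FILE 4's `radialTower_gaugeAct_blockLift`).
* §3 ★★★ `sum_dist1_fine_path_radialTower_le` — FILE 8's `sum_dist1_fine_path_le` at a radial-tower representative with `hint` DISCHARGED: the per-run sum for n07-w8 g5's `dist1_toMS_path_le_sum`
  with only (7) per level, the top letter and the windows displayed.

HONEST FRAMING (binding).  Count-neutral helper; by-name composition of LANDED theorems (this base FILES 4–8, dag-n07-w5 p630918 `…N07RadialGaugeWithinBlock`, dag-n07-e module 40); the per-level
(7)-smallness of the representative's averages, the top data letter, the blow-down∕window geometry and the ladder evaluation are HYPOTHESES ∕ the consumer's; nothing of [B11]∕[6]∕[B5] analysis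
asserted; `stub_prop8StepCoP13` ∕ K0⁷ ∕ K1⁹ NOT closed; N07 NOT discharged; the chair's tally of record is the only count; **no summit statement is proved by this seat** — one finite `T⁴` programme
at fixed `ε`, Bałaban AS PRINTED; the route closes the conditional finite-𝕋⁴ rung `BalabanLadder.UV` only; NOT continuum ∕ ℝ⁴ ∕ OS ∕ mass gap ∕ Clay.  No `sorry`, no `def`, no `instance`, no `notation`.
-/

noncomputable section

namespace Summit.QuantumFields.YangMills.BalabanUVNodes.N07DataDownTheRadialTower

open scoped Matrix.Norms.L2Operator BigOperators
open Literature.MathematicalPhysics.QuantumFieldTheory.Balaban1983to89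
open Literature.MathematicalPhysics.QuantumFieldTheory.Balaban1983to89.Node00
open T4Continuum
open T4AxialGaugeSmallField (castSite axialGauge boxPlaqs)
open B15Eq177GaugeInvariance (blockLift)
open GaugeField (gaugeAct)
open ExpMeanLog (deltaSU)
open Summit.QuantumFields.Balaban3D.Carriers (radialContourData)
open Summit.QuantumFields.YangMills.BalabanUVNodes.N07RadialGaugeWithinBlock (dist1_le_of_axialGauge_radial_hint)
open Summit.QuantumFields.YangMills.BalabanUVNodes.N07RadialAxialTower (radialTower_gaugeAct_blockLift)
open Summit.QuantumFields.YangMills.BalabanUVNodes.N07DataDownTheTowerBlowDown (dist1_iter_le_down_the_tower_blowDown dist1_iter_rep_le_down_the_tower_blowDown)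
open Summit.QuantumFields.YangMills.BalabanUVNodes.N07FinePathCrossingCount (sum_dist1_fine_path_le)

variable {F : T4Continuum.T4Family} {N : ℕ} [NeZero N] {K : ℕ}

/-! ## §1  The within-block letters of the radial tower -/

/-- ★ **`hint` FOR A RADIAL-TOWER REPRESENTATIVE** (dag-n07-w5's `dist1_le_of_axialGauge_radial_hint`, p630918, at every level): if the averages `M^i U′`, `i < k ≤ m + K`, carry the radial axial gauge and
the level-`i` plaquettes of `M^i U′` BASED in the blocks `y ∈ W (i+1)` are `< a_i` (`0 ≤ a_i`), then every level-`i` bond inside such a block has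
`dist1 (M^i U′ b) ≤ (d(L−1)+1)·((d−1)(L−1)·a_i)`. [cite: Balaban1985RegularSpaces, (1.15) p.78; Balaban1984PropagatorsI, (1.7) p.18; Balaban1985Variational, (145) p.301] -/
theorem hint_of_radialTower {k : ℕ} (hk : k ≤ (F.P K).m + (F.P K).K) (U' : GaugeField (F.P K) 0 (SU N))
    (hax : ∀ i < k, AxialGauge (radialContourData (F.P K) i (SU N)) (Averaging.iter (avOfRecord F N K) i U'))
    (W : ∀ i : ℕ, Set (Site (F.P K) i)) (a : ℕ → ℝ) (ha : ∀ i < k, 0 ≤ a i)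
    (hplaqB : ∀ i < k, ∀ y : Site (F.P K) (i + 1), y ∈ W (i + 1) → ∀ q : Plaq (F.P K) i, blockOf q.src = y →
      dist1 (GaugeField.plaqHol (Averaging.iter (avOfRecord F N K) i U') q) < a i) :
    ∀ i < k, ∀ b : PBond (F.P K) i, blockOf b.src = blockOf b.tgt → blockOf b.src ∈ W (i + 1) →
      dist1 (Averaging.iter (avOfRecord F N K) i U' b) ≤ ((((F.P K).d * ((F.P K).L - 1) + 1 : ℕ) : ℝ) * (((((F.P K).d - 1 : ℕ) : ℝ) * (((F.P K).L - 1 : ℕ) : ℝ)) * a i)) :=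
  fun i hi b hb hmem =>
    dist1_le_of_axialGauge_radial_hint (by omega) _ (hax i hi) (ha i hi) (blockOf b.src) (hplaqB i hi _ hmem) b hb rfl

/-! ## §2  (151) down the radial tower on blow-down boxes -/

/-- ★★★ **(155)∕(151) DOWN THE RADIAL TOWER ON BLOW-DOWN BOXES, within-block letters SUPPLIED**: FILE 6's `dist1_iter_le_down_the_tower_blowDown` for a representative `U′` whose averages carry the radial
tower below `k`, with `τ_i := (d(L−1)+1)(d−1)(L−1)·a_i` from §1 — displayed: the per-level plaquette letters of `M^i U′` (around the `(i+1)`-bonds of the level-`(i+1)` box AND based in its blocks), the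
top letter `v_k` on the top box, the blow-down corners, the ladder. [cite: Balaban1985Variational, (145)–(146) p.301, (151) p.301, (155) p.302; Balaban1985RegularSpaces, Lemma 1 (1.25) p.79] -/
theorem dist1_iter_le_down_the_radialTower_blowDown {k : ℕ} (hk : k ≤ (F.P K).m + (F.P K).K) (U' : GaugeField (F.P K) 0 (SU N))
    (hax : ∀ i < k, AxialGauge (radialContourData (F.P K) i (SU N)) (Averaging.iter (avOfRecord F N K) i U'))
    (lo hi : ℕ → Fin (F.P K).d → ℤ)
    (hlo : ∀ j < k, lo j = fun i => ((F.P K).L : ℤ) * lo (j + 1) i) (hhi : ∀ j < k, hi j = fun i => ((F.P K).L : ℤ) * hi (j + 1) i + (((F.P K).L : ℤ) - 1))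
    (a v : ℕ → ℝ) (ha : ∀ j < k, 0 ≤ a j)
    (ht : ∀ j < k, (((((F.P K).d + 2) * (F.P K).L : ℕ) : ℝ) ^ 2 / 4) * a j < deltaSU (Fin N))
    (hplaq : ∀ j < k, ∀ c : PBond (F.P K) (j + 1), c.src ∈ (castSite '' Set.Icc (lo (j + 1)) (hi (j + 1)) : Set (Site (F.P K) (j + 1))) →
      c.tgt ∈ (castSite '' Set.Icc (lo (j + 1)) (hi (j + 1)) : Set (Site (F.P K) (j + 1))) → ∀ q : Plaq (F.P K) j,
      (blockOf q.src = c.src.unshift c.dir ∨ blockOf q.src = c.src ∨ blockOf q.src = c.tgt) → dist1 (GaugeField.plaqHol (Averaging.iter (avOfRecord F N K) j U') q) < a j)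
    (hplaqB : ∀ j < k, ∀ y : Site (F.P K) (j + 1), y ∈ (castSite '' Set.Icc (lo (j + 1)) (hi (j + 1)) : Set (Site (F.P K) (j + 1))) → ∀ q : Plaq (F.P K) j, blockOf q.src = y →
      dist1 (GaugeField.plaqHol (Averaging.iter (avOfRecord F N K) j U') q) < a j)
    (htop : ∀ c : PBond (F.P K) k, c.src ∈ (castSite '' Set.Icc (lo k) (hi k) : Set (Site (F.P K) k)) → c.tgt ∈ (castSite '' Set.Icc (lo k) (hi k) : Set (Site (F.P K) k)) →
      dist1 (Averaging.iter (avOfRecord F N K) k U' c) ≤ v k)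
    (hv : ∀ j < k, max (((((F.P K).d * ((F.P K).L - 1) + 1 : ℕ) : ℝ) * (((((F.P K).d - 1 : ℕ) : ℝ) * (((F.P K).L - 1 : ℕ) : ℝ)) * a j)))
      (v (j + 1) + 7 * ((((((F.P K).d + 2) * (F.P K).L : ℕ) : ℝ) ^ 2 / 4) * a j) +
        ((((F.P K).d + 1) * ((F.P K).L - 1) : ℕ) : ℝ) * ((((F.P K).d * ((F.P K).L - 1) + 1 : ℕ) : ℝ) * (((((F.P K).d - 1 : ℕ) : ℝ) * (((F.P K).L - 1 : ℕ) : ℝ)) * a j))) ≤ v j) :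
    ∀ j ≤ k, ∀ c : PBond (F.P K) j, c.src ∈ (castSite '' Set.Icc (lo j) (hi j) : Set (Site (F.P K) j)) → c.tgt ∈ (castSite '' Set.Icc (lo j) (hi j) : Set (Site (F.P K) j)) →
      dist1 (Averaging.iter (avOfRecord F N K) j U' c) ≤ v j := by
  have hτ : ∀ j < k, (0 : ℝ) ≤ ((((F.P K).d * ((F.P K).L - 1) + 1 : ℕ) : ℝ) * (((((F.P K).d - 1 : ℕ) : ℝ) * (((F.P K).L - 1 : ℕ) : ℝ)) * a j)) := fun j hj => by
    have := ha j hj; positivity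
  exact dist1_iter_le_down_the_tower_blowDown hk U' lo hi hlo hhi a _ v ha hτ ht hplaq
    (hint_of_radialTower hk U' hax (fun i => (castSite '' Set.Icc (lo i) (hi i) : Set (Site (F.P K) i))) a ha hplaqB) htop hv

/-- ★★★★ **THE SAME AT THE (147) REPRESENTATIVE `U″ := U′^{h̄}` WITH THE TOP LETTER SUPPLIED**: `U′` carries the radial tower below `k ≤ m + K`; top box `[lo k, hi k]` with `hi k ≤ lo k + n`, non-wrapping
`n + 1 < N_k`; `h := axialGauge (M^k U′) (lo k) (hi k)`; the plaquettes of `M^k U′` based in the top box `< δ`.  Then `U″ := U′^{h̄}` carries the radial tower (FILE 4 `radialTower_gaugeAct_blockLift`),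
its within-block letters are §1's, its top letter is `(d−1)nδ` (module 40 via FILE 6), and every level-`j` blow-down box bond obeys `dist1 (M^j U″ c) ≤ v_j` for any ladder from `v_k ≥ (d−1)nδ` —
displayed: the per-level plaquette letters of `M^j U″` (both shapes; gauge-invariant, FILE 6 `dist1_plaqHol_iter_gaugeAct`), the corners, the ladder. [cite: Balaban1985Variational, (145)–(147) p.301, (151) p.301] -/
theorem dist1_iter_le_down_the_radialRep_blowDown {k : ℕ} (hk : k ≤ (F.P K).m + (F.P K).K) (U' : GaugeField (F.P K) 0 (SU N))
    (hax : ∀ i < k, AxialGauge (radialContourData (F.P K) i (SU N)) (Averaging.iter (avOfRecord F N K) i U'))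
    (lo hi : ℕ → Fin (F.P K).d → ℤ)
    (hlo : ∀ j < k, lo j = fun i => ((F.P K).L : ℤ) * lo (j + 1) i) (hhi : ∀ j < k, hi j = fun i => ((F.P K).L : ℤ) * hi (j + 1) i + (((F.P K).L : ℤ) - 1))
    {n : ℕ} (hn : ∀ κ, hi k κ ≤ lo k κ + n) (hnN : n + 1 < (F.P K).sitesPerDir k)
    {δ : ℝ} {S₀ : Set (Plaq (F.P K) k)} (hS₀ : boxPlaqs (lo k) (hi k) ⊆ S₀) (hV : PlaqSmallOn S₀ δ (Averaging.iter (avOfRecord F N K) k U')) (hδ : 0 ≤ δ)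
    (a v : ℕ → ℝ) (ha : ∀ j < k, 0 ≤ a j)
    (ht : ∀ j < k, (((((F.P K).d + 2) * (F.P K).L : ℕ) : ℝ) ^ 2 / 4) * a j < deltaSU (Fin N))
    (hplaq : ∀ j < k, ∀ c : PBond (F.P K) (j + 1), c.src ∈ (castSite '' Set.Icc (lo (j + 1)) (hi (j + 1)) : Set (Site (F.P K) (j + 1))) →
      c.tgt ∈ (castSite '' Set.Icc (lo (j + 1)) (hi (j + 1)) : Set (Site (F.P K) (j + 1))) → ∀ q : Plaq (F.P K) j,
      (blockOf q.src = c.src.unshift c.dir ∨ blockOf q.src = c.src ∨ blockOf q.src = c.tgt) →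
      dist1 (GaugeField.plaqHol (Averaging.iter (avOfRecord F N K) j
        (gaugeAct (blockLift k (axialGauge (Averaging.iter (avOfRecord F N K) k U') (lo k) (hi k))) U')) q) < a j)
    (hplaqB : ∀ j < k, ∀ y : Site (F.P K) (j + 1), y ∈ (castSite '' Set.Icc (lo (j + 1)) (hi (j + 1)) : Set (Site (F.P K) (j + 1))) → ∀ q : Plaq (F.P K) j, blockOf q.src = y →
      dist1 (GaugeField.plaqHol (Averaging.iter (avOfRecord F N K) j
        (gaugeAct (blockLift k (axialGauge (Averaging.iter (avOfRecord F N K) k U') (lo k) (hi k))) U')) q) < a j)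
    (hvk : (((F.P K).d - 1 : ℕ) : ℝ) * n * δ ≤ v k)
    (hv : ∀ j < k, max (((((F.P K).d * ((F.P K).L - 1) + 1 : ℕ) : ℝ) * (((((F.P K).d - 1 : ℕ) : ℝ) * (((F.P K).L - 1 : ℕ) : ℝ)) * a j)))
      (v (j + 1) + 7 * ((((((F.P K).d + 2) * (F.P K).L : ℕ) : ℝ) ^ 2 / 4) * a j) +
        ((((F.P K).d + 1) * ((F.P K).L - 1) : ℕ) : ℝ) * ((((F.P K).d * ((F.P K).L - 1) + 1 : ℕ) : ℝ) * (((((F.P K).d - 1 : ℕ) : ℝ) * (((F.P K).L - 1 : ℕ) : ℝ)) * a j))) ≤ v j) :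
    ∀ j ≤ k, ∀ c : PBond (F.P K) j, c.src ∈ (castSite '' Set.Icc (lo j) (hi j) : Set (Site (F.P K) j)) → c.tgt ∈ (castSite '' Set.Icc (lo j) (hi j) : Set (Site (F.P K) j)) →
      dist1 (Averaging.iter (avOfRecord F N K) j (gaugeAct (blockLift k (axialGauge (Averaging.iter (avOfRecord F N K) k U') (lo k) (hi k))) U') c) ≤ v j := by
  have hτ : ∀ j < k, (0 : ℝ) ≤ ((((F.P K).d * ((F.P K).L - 1) + 1 : ℕ) : ℝ) * (((((F.P K).d - 1 : ℕ) : ℝ) * (((F.P K).L - 1 : ℕ) : ℝ)) * a j)) := fun j hj => by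
    have := ha j hj; positivity
  have hax' : ∀ i < k, AxialGauge (radialContourData (F.P K) i (SU N))
      (Averaging.iter (avOfRecord F N K) i (gaugeAct (blockLift k (axialGauge (Averaging.iter (avOfRecord F N K) k U') (lo k) (hi k))) U')) :=
    radialTower_gaugeAct_blockLift F N K hk _ U' hax
  exact dist1_iter_rep_le_down_the_tower_blowDown hk U' lo hi hlo hhi hn hnN hS₀ hV hδ a _ v ha hτ ht hplaq
    (hint_of_radialTower hk _ hax' (fun i => (castSite '' Set.Icc (lo i) (hi i) : Set (Site (F.P K) i))) a ha hplaqB) hvk hv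

/-! ## §3  The fine-path sum at a radial-tower representative -/

/-- ★★★ **THE FINE-PATH SUM AT A RADIAL-TOWER REPRESENTATIVE, within-block letters SUPPLIED**: FILE 8's `sum_dist1_fine_path_le` with `τ_i := (d(L−1)+1)(d−1)(L−1)·a_i` from §1 — the per-run summand for
n07-w8 g5's variation door, displayed: per-level plaquette letters of `M^i U′` (both shapes), the top letter `v_k` on the top window, windows nested under blocking, the path data.
[cite: Balaban1985Variational, (145) p.301; Balaban1985RegularSpaces, (1.15) p.78, Lemma 1 (1.25) p.79] -/
theorem sum_dist1_fine_path_radialTower_le {k : ℕ} (hk1 : 1 ≤ k) (hk : k ≤ (F.P K).m + (F.P K).K) (U' : GaugeField (F.P K) 0 (SU N))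
    (hax : ∀ i < k, AxialGauge (radialContourData (F.P K) i (SU N)) (Averaging.iter (avOfRecord F N K) i U'))
    (W : ∀ i : ℕ, Set (Site (F.P K) i)) (a : ℕ → ℝ) {vk : ℝ}
    (hnest : ∀ i < k, ∀ x : Site (F.P K) i, x ∈ W i → blockOf x ∈ W (i + 1))
    (ha : ∀ i < k, 0 ≤ a i) (hvk : 0 ≤ vk)
    (ht : ∀ i < k, (((((F.P K).d + 2) * (F.P K).L : ℕ) : ℝ) ^ 2 / 4) * a i < deltaSU (Fin N))
    (hplaq : ∀ i < k, ∀ c : PBond (F.P K) (i + 1), c.src ∈ W (i + 1) → c.tgt ∈ W (i + 1) → ∀ q : Plaq (F.P K) i,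
      (blockOf q.src = c.src.unshift c.dir ∨ blockOf q.src = c.src ∨ blockOf q.src = c.tgt) → dist1 (GaugeField.plaqHol (Averaging.iter (avOfRecord F N K) i U') q) < a i)
    (hplaqB : ∀ i < k, ∀ y : Site (F.P K) (i + 1), y ∈ W (i + 1) → ∀ q : Plaq (F.P K) i, blockOf q.src = y →
      dist1 (GaugeField.plaqHol (Averaging.iter (avOfRecord F N K) i U') q) < a i)
    (htop : ∀ c : PBond (F.P K) k, c.src ∈ W k → c.tgt ∈ W k → dist1 (Averaging.iter (avOfRecord F N K) k U' c) ≤ vk)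
    (b : ℕ → PBond (F.P K) 0) {μ : Fin (F.P K).d} {v₀ n : ℕ} (hdir : ∀ s < n, (b s).dir = μ) (hval : ∀ s < n, ((b s).src μ).val = v₀ + s)
    (hwrap : v₀ + n + 1 ≤ (F.P K).sitesPerDir 0) (hbW : ∀ s < n, (b s).src ∈ W 0 ∧ (b s).tgt ∈ W 0) :
    ∑ s ∈ Finset.range n, dist1 (U' (b s)) ≤
      (n : ℝ) * (((((F.P K).d * ((F.P K).L - 1) + 1 : ℕ) : ℝ) * (((((F.P K).d - 1 : ℕ) : ℝ) * (((F.P K).L - 1 : ℕ) : ℝ)) * a 0)) +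
          (7 * ((((((F.P K).d + 2) * (F.P K).L : ℕ) : ℝ) ^ 2 / 4) * a 0) +
            ((((F.P K).d + 1) * ((F.P K).L - 1) : ℕ) : ℝ) * ((((F.P K).d * ((F.P K).L - 1) + 1 : ℕ) : ℝ) * (((((F.P K).d - 1 : ℕ) : ℝ) * (((F.P K).L - 1 : ℕ) : ℝ)) * a 0)))) +
        ∑ i ∈ Finset.range k, (((n / (F.P K).L ^ (i + 1) + 1 : ℕ)) : ℝ) *
          (if i + 1 < k then
              ((((F.P K).d * ((F.P K).L - 1) + 1 : ℕ) : ℝ) * (((((F.P K).d - 1 : ℕ) : ℝ) * (((F.P K).L - 1 : ℕ) : ℝ)) * a (i + 1))) +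
                (7 * ((((((F.P K).d + 2) * (F.P K).L : ℕ) : ℝ) ^ 2 / 4) * a (i + 1)) +
                  ((((F.P K).d + 1) * ((F.P K).L - 1) : ℕ) : ℝ) * ((((F.P K).d * ((F.P K).L - 1) + 1 : ℕ) : ℝ) * (((((F.P K).d - 1 : ℕ) : ℝ) * (((F.P K).L - 1 : ℕ) : ℝ)) * a (i + 1))))
            else vk) := by
  have hτ : ∀ j < k, (0 : ℝ) ≤ ((((F.P K).d * ((F.P K).L - 1) + 1 : ℕ) : ℝ) * (((((F.P K).d - 1 : ℕ) : ℝ) * (((F.P K).L - 1 : ℕ) : ℝ)) * a j)) := fun j hj => by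
    have := ha j hj; positivity
  exact sum_dist1_fine_path_le hk1 hk U' W a _ hnest ha hτ hvk ht hplaq (hint_of_radialTower hk U' hax W a ha hplaqB) htop b hdir hval hwrap hbW

end Summit.QuantumFields.YangMills.BalabanUVNodes.N07DataDownTheRadialTower
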